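import Mathlib
import Literature.Probability.Process.BrownianModulus
import Literature.Probability.Distributions.GaussianPiDensity
import HarnessLib

/-!
# A Gaussian toolkit: densities and small-ball / sup-norm bounds for multivariate Gaussians

Mathlib-generic measure theory used by the lattice Maxwell (Gaussian) theory of Chatterjee,
*The leading term of the Yang–Mills free energy*, J. Funct. Anal. 271 (2016), arXiv:1602.01222,
§§12–14 — fourth step of the inline proof of the named fact
`Literature.MathematicalPhysics.QuantumFieldTheory.chatterjee_freeEnergyDensity`. Everything is
proved; no named fact is introduced; besides `Mathlib` only `BrownianModulus` (sub-Gaussian MGF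
of the real Gaussian) and `GaussianPiDensity` (Tonelli for products over `Fin n`) are imported.

* **Tonelli for products** `lintegral_fintype_prod_eq_prod` (`∫ ∏ᵢ fᵢ(xᵢ) d⊗μᵢ = ∏ᵢ ∫ fᵢ dμᵢ` over a
  `Fintype`, from the tree's `Fin n` version in `GaussianPiDensity`), `pi_withDensity`,
  `map_withDensity_equiv`, `lintegral_comp_smul` (scaling of Lebesgue integrals).
* **Densities**: `stdGaussian_eq_withDensity` (the standard Gaussian of Euclidean `ℝ^ι` has density
  `(2π)^{-|ι|/2} e^{-‖y‖²/2}`), `multivariateGaussian_eq_withDensity` /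
  `multivariateGaussian_inv_eq_withDensity` (for positive definite `P`, Mathlib's
  `multivariateGaussian 0 P⁻¹` is `Z_P⁻¹ e^{-½ yᵀPy} dy` with `Z_P = gaussZ P ∈ (0,∞)`; proved by
  pushing the standard density through `y ↦ √(P⁻¹) y`, `sqrtCLE`, with `CFC.sqrt`),
  `lintegral_exp_neg_norm_sq_div_two` (`∫ e^{-‖y‖²/2} = (2π)^{|ι|/2}`), `gaussZ_le`.
* **Quadratic forms**: `dotProduct_mulVec_sq_le` (Cauchy–Schwarz for a PSD form),
  `norm_inv_mulVec_le`, `inv_form_bounds` (`c ≤ P ≤ C ⟹ C⁻¹ ≤ P⁻¹ ≤ c⁻¹`), `posDef_submatrix`,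
  `inv_diag_bounds`.
* **Marginals**: `restrictJ`, `measurePreserving_restrictJ` (restriction of `N(0,S)` to the
  coordinates of `J : Finset ι` is `N(0, S_J)`; Mathlib has this only for Finset-indexed ambient types).
* **Chatterjee §12**: `le_multivariateGaussian_cube` (the lower bound (`cruciallower`)
  `P(|x_j| ≤ η, j ∈ J) ≥ (2η √(c/2π) e^{-Cη²/2})^{|J|}` for `N(0, P⁻¹)` with `c ≤ P ≤ C`, via the
  marginal density), `multivariateGaussian_real_coord_abs_ge_le`,
  `multivariateGaussian_real_forall_abs_le_ge`, `…_abs_add_le_ge` (the union bound (`gaussmax`)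
  `P(max|s_i| ≤ x) ≥ 1 - 2|ι| e^{-cx²/2}` and its shifted form), `gaussianReal_real_abs_ge_le`
  (real Gaussian tails via `HasSubgaussianMGF`, tree `BrownianModulus.hasSubgaussianMGF_id_gaussianReal`).

## References

* S. Chatterjee, *The leading term of the Yang–Mills free energy*, J. Funct. Anal. 271 (2016)
  2944–3005, arXiv:1602.01222, §12 (standard facts about Gaussian measures: (12.x) `cruciallower`,
  `gaussmax`), §14 (Thm. 14.1, 14.2, where they are used). [arXiv160201222]
-/

noncomputable section

open MeasureTheory Measure ProbabilityTheory Set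
open scoped ENNReal NNReal

namespace Literature.MathematicalPhysics.QuantumFieldTheory

namespace GaussianToolkit

/-! ### Products of one-variable functions under finite product measures -/

/-- **Tonelli for products** over a finite index type (dependent version), from the `Fin n` case
`Literature.Probability.Distributions.lintegral_fin_nat_prod_eq_prod` (`GaussianPiDensity`). The same
`Fintype` generalisation is proved inside the kinetic-theory proof file `HardSphereEulerProofs`
(`lintegral_fintype_prod_eq_prod'`), which is not a sensible import here; a librarian may merge the
two. [folklore] -/
theorem lintegral_fintype_prod_eq_prod_dep {ι : Type*} [Fintype ι] {E : ι → Type*}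
    [∀ i, MeasurableSpace (E i)] (μ : ∀ i, Measure (E i)) [∀ i, SigmaFinite (μ i)]
    {f : ∀ i, E i → ℝ≥0∞} (hf : ∀ i, Measurable (f i)) :
    ∫⁻ x, ∏ i, f i (x i) ∂(Measure.pi μ) = ∏ i, ∫⁻ x, f i x ∂(μ i) := by
  let e := (Fintype.equivFin ι).symm
  rw [← (measurePreserving_piCongrLeft _ e).lintegral_comp_emb (MeasurableEquiv.measurableEmbedding _)]
  simp_rw [← e.prod_comp, MeasurableEquiv.coe_piCongrLeft, Equiv.piCongrLeft_apply_apply,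
    Literature.Probability.Distributions.lintegral_fin_nat_prod_eq_prod _ _ (fun i => hf _)]

/-- **Tonelli for products** over a finite index type. [folklore] -/
theorem lintegral_fintype_prod_eq_prod {ι : Type*} [Fintype ι] {E : Type*} [MeasurableSpace E]
    (μ : ι → Measure E) [∀ i, SigmaFinite (μ i)] {f : ι → E → ℝ≥0∞} (hf : ∀ i, Measurable (f i)) :
    ∫⁻ x, ∏ i, f i (x i) ∂(Measure.pi μ) = ∏ i, ∫⁻ x, f i x ∂(μ i) :=
  lintegral_fintype_prod_eq_prod_dep μ hf

/-! ### Product of measures with densities -/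

/-- `⊗ᵢ (fᵢ μᵢ) = (∏ᵢ fᵢ(xᵢ)) ⊗ᵢ μᵢ`. [folklore] -/
theorem pi_withDensity {ι : Type*} [Fintype ι] {E : Type*} [MeasurableSpace E] (μ : ι → Measure E)
    [∀ i, SigmaFinite (μ i)] (f : ι → E → ℝ≥0∞) (hf : ∀ i, Measurable (f i))
    [∀ i, SigmaFinite ((μ i).withDensity (f i))] :
    Measure.pi (fun i => (μ i).withDensity (f i)) = (Measure.pi μ).withDensity fun x => ∏ i, f i (x i) := by
  refine Measure.pi_eq fun s hs => ?_
  rw [withDensity_apply _ (MeasurableSet.univ_pi hs), Measure.restrict_pi_pi,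
    lintegral_fintype_prod_eq_prod _ hf]
  exact Finset.prod_congr rfl fun i _ => (withDensity_apply _ (hs i)).symm

/-! ### Images of measures with density under measurable equivalences -/

/-- `e_* (f μ) = (f ∘ e⁻¹) (e_* μ)` for a measurable equivalence `e`. [folklore] -/
theorem map_withDensity_equiv {α β : Type*} [MeasurableSpace α] [MeasurableSpace β] (e : α ≃ᵐ β)
    (μ : Measure α) (f : α → ℝ≥0∞) :
    (μ.withDensity f).map e = (μ.map e).withDensity (f ∘ e.symm) := by
  ext s hs
  rw [e.map_apply, withDensity_apply _ hs, withDensity_apply _ (e.measurable hs),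
    e.restrict_map, lintegral_map_equiv]
  simp [Function.comp]

/-! ### The density of the standard and of non-degenerate multivariate Gaussian measures -/

section Density

variable {ι : Type*} [Fintype ι]

/-- `gaussianReal 0 1 = volume.withDensity (gaussianPDF 0 1)` is sigma-finite under this spelling. [folklore] -/
instance sigmaFinite_withDensity_gaussianPDF :
    SigmaFinite ((volume : Measure ℝ).withDensity (gaussianPDF 0 1)) := by
  rw [← gaussianReal_of_var_ne_zero 0 one_ne_zero]; infer_instance

/-- The product of standard real Gaussians has density `∏ᵢ φ(xᵢ)` w.r.t. Lebesgue measure on `ℝ^ι`. [folklore] -/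
theorem pi_gaussianReal_eq_withDensity :
    (Measure.pi fun _ : ι => gaussianReal 0 1) =
      (volume : Measure (ι → ℝ)).withDensity fun x => ∏ i, gaussianPDF 0 1 (x i) := by
  rw [gaussianReal_of_var_ne_zero 0 one_ne_zero, volume_pi]
  exact pi_withDensity (fun _ : ι => (volume : Measure ℝ)) (fun _ => gaussianPDF 0 1)
    (fun _ => measurable_gaussianPDF 0 1)

/-- The product density `∏ᵢ φ(xᵢ) = (2π)^{-|ι|/2} e^{-Σ xᵢ²/2}`. [folklore] -/
theorem prod_gaussianPDF_eq (x : ι → ℝ) :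
    ∏ i, gaussianPDF 0 1 (x i) =
      ENNReal.ofReal ((Real.sqrt (2 * Real.pi))⁻¹ ^ Fintype.card ι * Real.exp (-(∑ i, x i ^ 2) / 2)) := by
  simp only [gaussianPDF, gaussianPDFReal]
  rw [← ENNReal.ofReal_prod_of_nonneg fun i _ => by positivity]
  congr 1
  rw [Finset.prod_mul_distrib, Finset.prod_const, Finset.card_univ, ← Real.exp_sum, ← Finset.sum_div,
    ← Finset.sum_neg_distrib]
  simp

variable (ι) in
/-- The weight `(2π)^{-|ι|/2} e^{-‖y‖²/2}` of the standard Gaussian on Euclidean `ℝ^ι`. [folklore] -/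
def stdGaussianDensity (y : EuclideanSpace ℝ ι) : ℝ≥0∞ :=
  ENNReal.ofReal ((Real.sqrt (2 * Real.pi))⁻¹ ^ Fintype.card ι * Real.exp (-‖y‖ ^ 2 / 2))

/-- The standard Gaussian density is measurable. [folklore] -/
theorem measurable_stdGaussianDensity : Measurable (stdGaussianDensity ι) := by
  unfold stdGaussianDensity; fun_prop

/-- **The standard Gaussian on Euclidean `ℝ^ι` has density `(2π)^{-|ι|/2} e^{-‖y‖²/2}`** with respect
to Lebesgue measure. [folklore] -/
theorem stdGaussian_eq_withDensity :
    stdGaussian (EuclideanSpace ℝ ι) = (volume : Measure (EuclideanSpace ℝ ι)).withDensity (stdGaussianDensity ι) := by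
  rw [← map_pi_eq_stdGaussian, pi_gaussianReal_eq_withDensity]
  have h := map_withDensity_equiv (MeasurableEquiv.toLp 2 (ι → ℝ)) (volume : Measure (ι → ℝ))
    (fun x => ∏ i, gaussianPDF 0 1 (x i))
  rw [MeasurableEquiv.coe_toLp, (PiLp.volume_preserving_toLp ι).map_eq] at h
  rw [h]
  congr 1
  funext y
  simp only [Function.comp_apply, MeasurableEquiv.coe_toLp_symm, prod_gaussianPDF_eq, stdGaussianDensity,
    EuclideanSpace.real_norm_sq_eq]

end Density

/-! ### Non-degenerate multivariate Gaussians: density with respect to Lebesgue measure -/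

section Multivariate

open scoped MatrixOrder
open Matrix WithLp

variable {ι : Type*} [Fintype ι] [DecidableEq ι]

/-- The Gaussian weight `w_P(y) = e^{-½ yᵀ P y}` of the precision matrix `P`. [folklore] -/
def gaussWeight (P : Matrix ι ι ℝ) (y : EuclideanSpace ℝ ι) : ℝ≥0∞ :=
  ENNReal.ofReal (Real.exp (-(ofLp y ⬝ᵥ P *ᵥ ofLp y) / 2))

/-- Its Lebesgue integral `Z_P = ∫ e^{-½ yᵀ P y} dy` (finite and positive for positive definite
`P`, see `gaussZ_ne_zero`, `gaussZ_ne_top`). [folklore] -/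
def gaussZ (P : Matrix ι ι ℝ) : ℝ≥0∞ := ∫⁻ y, gaussWeight P y

omit [DecidableEq ι] in
/-- The Gaussian weight is continuous. [folklore] -/
theorem continuous_gaussWeight (P : Matrix ι ι ℝ) : Continuous (gaussWeight P) := by
  unfold gaussWeight
  refine ENNReal.continuous_ofReal.comp (Real.continuous_exp.comp ?_)
  refine (Continuous.neg ?_).div_const _
  have h1 : Continuous fun y : EuclideanSpace ℝ ι => (ofLp y : ι → ℝ) := PiLp.continuous_ofLp 2 _
  exact h1.dotProduct (continuous_const.matrix_mulVec h1)

omit [DecidableEq ι] in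
/-- The Gaussian weight is measurable. [folklore] -/
theorem measurable_gaussWeight (P : Matrix ι ι ℝ) : Measurable (gaussWeight P) :=
  (continuous_gaussWeight P).measurable

section Sqrt

variable {S : Matrix ι ι ℝ}

/-- `√S √S = S`. [folklore] -/
theorem sqrt_mul_sqrt (hS : S.PosDef) : CFC.sqrt S * CFC.sqrt S = S :=
  CFC.sqrt_mul_sqrt_self S hS.posSemidef.nonneg

/-- `√S` is invertible. [folklore] -/
theorem isUnit_sqrt (hS : S.PosDef) : IsUnit (CFC.sqrt S) :=
  (CFC.isUnit_sqrt_iff S hS.posSemidef.nonneg).2 hS.isUnit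

/-- `√S` is symmetric. [folklore] -/
theorem transpose_sqrt : (CFC.sqrt S)ᵀ = CFC.sqrt S := by
  have h : (CFC.sqrt S)ᴴ = CFC.sqrt S := (CFC.sqrt_nonneg S).isSelfAdjoint
  rwa [Matrix.conjTranspose_eq_transpose_of_trivial] at h

/-- `(√S)⁻¹ (√S)⁻¹ = S⁻¹`. [folklore] -/
theorem sqrt_inv_mul_sqrt_inv (hS : S.PosDef) : (CFC.sqrt S)⁻¹ * (CFC.sqrt S)⁻¹ = S⁻¹ := by
  rw [← Matrix.mul_inv_rev, sqrt_mul_sqrt hS]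

/-- The linear automorphism `y ↦ √S y` of Euclidean `ℝ^ι`. [folklore] -/
def sqrtCLE (hS : S.PosDef) : EuclideanSpace ℝ ι ≃L[ℝ] EuclideanSpace ℝ ι :=
  ContinuousLinearEquiv.unitsEquiv ℝ _ ((isUnit_sqrt hS).map (toEuclideanCLM (n := ι) (𝕜 := ℝ))).unit

/-- `sqrtCLE hS y = √S y`. [folklore] -/
theorem sqrtCLE_apply (hS : S.PosDef) (y : EuclideanSpace ℝ ι) :
    sqrtCLE hS y = toEuclideanCLM (n := ι) (𝕜 := ℝ) (CFC.sqrt S) y := rfl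

/-- `(sqrtCLE hS)⁻¹ y = (√S)⁻¹ y`. [folklore] -/
theorem sqrtCLE_symm_apply (hS : S.PosDef) (y : EuclideanSpace ℝ ι) :
    (sqrtCLE hS).symm y = toEuclideanCLM (n := ι) (𝕜 := ℝ) (CFC.sqrt S)⁻¹ y := by
  have hu := (isUnit_sqrt hS).map (toEuclideanCLM (n := ι) (𝕜 := ℝ))
  have hinv : ((hu.unit⁻¹ : (EuclideanSpace ℝ ι →L[ℝ] EuclideanSpace ℝ ι)ˣ) :
      EuclideanSpace ℝ ι →L[ℝ] EuclideanSpace ℝ ι) = toEuclideanCLM (n := ι) (𝕜 := ℝ) (CFC.sqrt S)⁻¹ := by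
    apply Units.inv_eq_of_mul_eq_one_left
    rw [IsUnit.unit_spec, ← map_mul,
      Matrix.nonsing_inv_mul _ ((Matrix.isUnit_iff_isUnit_det _).1 (isUnit_sqrt hS)), map_one]
  exact congrArg (fun T : EuclideanSpace ℝ ι →L[ℝ] EuclideanSpace ℝ ι => T y) hinv

/-- `‖(√S)⁻¹ y‖² = yᵀ S⁻¹ y`. [folklore] -/
theorem norm_sqrtCLE_symm_sq (hS : S.PosDef) (y : EuclideanSpace ℝ ι) :
    ‖(sqrtCLE hS).symm y‖ ^ 2 = ofLp y ⬝ᵥ S⁻¹ *ᵥ ofLp y := by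
  rw [sqrtCLE_symm_apply, ← real_inner_self_eq_norm_sq, EuclideanSpace.inner_eq_star_dotProduct,
    star_trivial, ofLp_toEuclideanCLM, Matrix.dotProduct_mulVec]
  conv_lhs => rw [← Matrix.vecMul_transpose, Matrix.vecMul_vecMul, Matrix.transpose_nonsing_inv,
    transpose_sqrt, sqrt_inv_mul_sqrt_inv hS]
  rw [Matrix.dotProduct_mulVec]

/-- `multivariateGaussian 0 S` is the image of the standard Gaussian under `y ↦ √S y`. [folklore] -/
theorem multivariateGaussian_zero_eq_map (hS : S.PosDef) :
    multivariateGaussian 0 S = (stdGaussian (EuclideanSpace ℝ ι)).map (sqrtCLE hS) := by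
  rw [multivariateGaussian]
  congr 1
  funext x
  rw [zero_add]
  rfl

/-- Lebesgue measure under `y ↦ √S y`. [folklore] -/
theorem map_sqrtCLE_volume (hS : S.PosDef) :
    (volume : Measure (EuclideanSpace ℝ ι)).map (sqrtCLE hS) =
      ENNReal.ofReal |(LinearMap.det ((sqrtCLE hS).toLinearEquiv : EuclideanSpace ℝ ι →ₗ[ℝ] EuclideanSpace ℝ ι))⁻¹| •
        volume := by
  have h := Measure.map_linearMap_addHaar_eq_smul_addHaar (volume : Measure (EuclideanSpace ℝ ι))
    (f := ((sqrtCLE hS).toLinearEquiv : EuclideanSpace ℝ ι →ₗ[ℝ] EuclideanSpace ℝ ι))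
    (LinearEquiv.isUnit_det' (sqrtCLE hS).toLinearEquiv).ne_zero
  exact h

/-- **Unnormalised density of a non-degenerate centred multivariate Gaussian**: for positive definite
`S`, `multivariateGaussian 0 S = K · e^{-½ yᵀ S⁻¹ y} dy` for some constant `K`. [folklore] -/
theorem exists_multivariateGaussian_eq_smul_withDensity (hS : S.PosDef) :
    ∃ K : ℝ≥0∞, multivariateGaussian 0 S = K • (volume : Measure (EuclideanSpace ℝ ι)).withDensity (gaussWeight S⁻¹) := by
  set T := sqrtCLE hS with hT
  set e : EuclideanSpace ℝ ι ≃ᵐ EuclideanSpace ℝ ι := T.toHomeomorph.toMeasurableEquiv with he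
  have hecoe : (e : EuclideanSpace ℝ ι → EuclideanSpace ℝ ι) = T := rfl
  set A : ℝ := (Real.sqrt (2 * Real.pi))⁻¹ ^ Fintype.card ι with hA
  have hA0 : 0 ≤ A := by positivity
  refine ⟨ENNReal.ofReal |(LinearMap.det (T.toLinearEquiv : EuclideanSpace ℝ ι →ₗ[ℝ] EuclideanSpace ℝ ι))⁻¹| *
    ENNReal.ofReal A, ?_⟩
  rw [multivariateGaussian_zero_eq_map hS, stdGaussian_eq_withDensity, ← hT, ← hecoe, map_withDensity_equiv, hecoe,
    map_sqrtCLE_volume hS, withDensity_smul_measure, mul_smul, ← withDensity_smul _ (measurable_gaussWeight _)]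
  congr 2
  funext y
  simp only [Function.comp_apply, Pi.smul_apply, smul_eq_mul, stdGaussianDensity, gaussWeight]
  rw [← ENNReal.ofReal_mul hA0]
  congr 1
  have hy : e.symm y = T.symm y := rfl
  rw [hy, norm_sqrtCLE_symm_sq hS, neg_div]

/-- **Density of a non-degenerate centred multivariate Gaussian**: for positive definite `S`,
`multivariateGaussian 0 S = Z⁻¹ e^{-½ yᵀ S⁻¹ y} dy` with `Z = ∫ e^{-½ yᵀ S⁻¹ y} dy ∈ (0, ∞)`. [folklore] -/
theorem multivariateGaussian_eq_withDensity (hS : S.PosDef) :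
    multivariateGaussian 0 S = (gaussZ S⁻¹)⁻¹ • (volume : Measure (EuclideanSpace ℝ ι)).withDensity (gaussWeight S⁻¹) ∧
      gaussZ S⁻¹ ≠ 0 ∧ gaussZ S⁻¹ ≠ ∞ := by
  obtain ⟨K, hK⟩ := exists_multivariateGaussian_eq_smul_withDensity hS
  have h1 : K * gaussZ S⁻¹ = 1 := by
    have h := congrArg (fun μ : Measure (EuclideanSpace ℝ ι) => μ Set.univ) hK
    simp only [measure_univ, Measure.smul_apply, withDensity_apply _ MeasurableSet.univ,
      Measure.restrict_univ, smul_eq_mul] at h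
    exact h.symm
  have hZ0 : gaussZ S⁻¹ ≠ 0 := fun h0 => by rw [h0, mul_zero] at h1; exact zero_ne_one h1
  have hZtop : gaussZ S⁻¹ ≠ ∞ := fun ht => by
    rw [ht] at h1
    rcases eq_or_ne K 0 with hK0 | hK0
    · rw [hK0, zero_mul] at h1; exact zero_ne_one h1
    · rw [ENNReal.mul_top hK0] at h1; exact ENNReal.top_ne_one h1
  have hKZ : K = (gaussZ S⁻¹)⁻¹ := ENNReal.eq_inv_of_mul_eq_one_left h1
  exact ⟨by rw [hK, hKZ], hZ0, hZtop⟩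

end Sqrt

/-- **The Gaussian measure of a positive definite precision matrix**: for positive definite `P`, the
probability measure `Z_P⁻¹ e^{-½ yᵀ P y} dy` on Euclidean `ℝ^ι` is the multivariate Gaussian with
mean `0` and covariance matrix `P⁻¹`; `Z_P ∈ (0, ∞)`. [folklore] -/
theorem multivariateGaussian_inv_eq_withDensity {P : Matrix ι ι ℝ} (hP : P.PosDef) :
    multivariateGaussian 0 P⁻¹ = (gaussZ P)⁻¹ • (volume : Measure (EuclideanSpace ℝ ι)).withDensity (gaussWeight P) ∧
      gaussZ P ≠ 0 ∧ gaussZ P ≠ ∞ := by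
  have h := multivariateGaussian_eq_withDensity hP.inv
  rwa [Matrix.nonsing_inv_nonsing_inv P ((Matrix.isUnit_iff_isUnit_det _).1 hP.isUnit)] at h


end Multivariate

/-! ### Quadratic forms: Cauchy–Schwarz, bounds for the inverse -/

section Forms

open Matrix

variable {ι : Type*} [Fintype ι] [DecidableEq ι]

omit [DecidableEq ι] in
/-- **Cauchy–Schwarz for a positive semidefinite form**: `(aᵀPb)² ≤ (aᵀPa)(bᵀPb)` for symmetric `P`
with `vᵀPv ≥ 0`. [folklore] -/
theorem dotProduct_mulVec_sq_le {P : Matrix ι ι ℝ} (hPt : Pᵀ = P) (hnn : ∀ v, 0 ≤ v ⬝ᵥ P *ᵥ v)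
    (a b : ι → ℝ) : (a ⬝ᵥ P *ᵥ b) ^ 2 ≤ (a ⬝ᵥ P *ᵥ a) * (b ⬝ᵥ P *ᵥ b) := by
  have hsymm : ∀ u w : ι → ℝ, u ⬝ᵥ P *ᵥ w = w ⬝ᵥ P *ᵥ u := fun u w => by
    rw [Matrix.dotProduct_mulVec, ← Matrix.vecMul_transpose, hPt, dotProduct_comm]
  -- `q(t) = (a - t b)ᵀ P (a - t b) ≥ 0` for all `t`
  have hq : ∀ t : ℝ, 0 ≤ (a ⬝ᵥ P *ᵥ a) - 2 * t * (a ⬝ᵥ P *ᵥ b) + t ^ 2 * (b ⬝ᵥ P *ᵥ b) := fun t => by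
    have h := hnn (a - t • b)
    have e : (a - t • b) ⬝ᵥ P *ᵥ (a - t • b) =
        (a ⬝ᵥ P *ᵥ a) - 2 * t * (a ⬝ᵥ P *ᵥ b) + t ^ 2 * (b ⬝ᵥ P *ᵥ b) := by
      simp only [Matrix.mulVec_sub, Matrix.mulVec_smul, sub_dotProduct, dotProduct_sub, dotProduct_smul,
        smul_dotProduct, smul_eq_mul, hsymm b a]
      ring
    rwa [e] at h
  set A := a ⬝ᵥ P *ᵥ a
  set B := a ⬝ᵥ P *ᵥ b
  set C := b ⬝ᵥ P *ᵥ b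
  have hA : 0 ≤ A := hnn a
  have hC : 0 ≤ C := hnn b
  rcases eq_or_lt_of_le hC with hC0 | hCpos
  · -- `C = 0`: then `B = 0` (take `t → ±∞`)
    have hB : B = 0 := by
      by_contra hB
      have h1 := hq ((A + 1) / (2 * B))
      rw [← hC0, mul_zero, add_zero] at h1
      have : 2 * ((A + 1) / (2 * B)) * B = A + 1 := by field_simp
      linarith
    rw [hB, ← hC0]; simp
  · have h1 := hq (B / C)
    have e : A - 2 * (B / C) * B + (B / C) ^ 2 * C = A - B ^ 2 / C := by field_simp; ring
    rw [e, sub_nonneg, div_le_iff₀ hCpos] at h1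
    linarith

/-- For `P` symmetric with `c‖v‖² ≤ vᵀPv` (`c > 0`) and `w = P⁻¹ v`: `‖w‖ ≤ ‖v‖/c`
(operator bound for the inverse). [folklore] -/
theorem norm_inv_mulVec_le {P : Matrix ι ι ℝ} (hP : P.PosDef) {c : ℝ} (hc : 0 < c)
    (hlow : ∀ v : ι → ℝ, c * ‖(WithLp.toLp 2 v : EuclideanSpace ℝ ι)‖ ^ 2 ≤ v ⬝ᵥ P *ᵥ v) (v : ι → ℝ) :
    ‖(WithLp.toLp 2 (P⁻¹ *ᵥ v) : EuclideanSpace ℝ ι)‖ ≤ ‖(WithLp.toLp 2 v : EuclideanSpace ℝ ι)‖ / c := by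
  have hu := (Matrix.isUnit_iff_isUnit_det _).1 hP.isUnit
  set w := P⁻¹ *ᵥ v with hw
  have hv : P *ᵥ w = v := by rw [hw, Matrix.mulVec_mulVec, Matrix.mul_nonsing_inv _ hu, Matrix.one_mulVec]
  have h1 : c * ‖(WithLp.toLp 2 w : EuclideanSpace ℝ ι)‖ ^ 2 ≤ w ⬝ᵥ v := by rw [← hv]; exact hlow w
  have h2 : w ⬝ᵥ v ≤ ‖(WithLp.toLp 2 w : EuclideanSpace ℝ ι)‖ * ‖(WithLp.toLp 2 v : EuclideanSpace ℝ ι)‖ := by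
    have := real_inner_le_norm (WithLp.toLp 2 v : EuclideanSpace ℝ ι) (WithLp.toLp 2 w)
    rwa [EuclideanSpace.inner_toLp_toLp, star_trivial, mul_comm] at this
  rw [le_div_iff₀ hc]
  by_cases h0 : ‖(WithLp.toLp 2 w : EuclideanSpace ℝ ι)‖ = 0
  · rw [h0, zero_mul]; exact norm_nonneg _
  · have hpos : 0 < ‖(WithLp.toLp 2 w : EuclideanSpace ℝ ι)‖ := lt_of_le_of_ne (norm_nonneg _) (Ne.symm h0)
    nlinarith

/-- **Form bounds for the inverse**: if `P` is positive definite with `c‖v‖² ≤ vᵀPv ≤ C‖v‖²`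
(`c > 0`), then `C⁻¹‖v‖² ≤ vᵀP⁻¹v ≤ c⁻¹‖v‖²`. [folklore] -/
theorem inv_form_bounds {P : Matrix ι ι ℝ} (hP : P.PosDef) {c C : ℝ} (hc : 0 < c)
    (hlow : ∀ v : ι → ℝ, c * ‖(WithLp.toLp 2 v : EuclideanSpace ℝ ι)‖ ^ 2 ≤ v ⬝ᵥ P *ᵥ v)
    (hup : ∀ v : ι → ℝ, v ⬝ᵥ P *ᵥ v ≤ C * ‖(WithLp.toLp 2 v : EuclideanSpace ℝ ι)‖ ^ 2) (v : ι → ℝ) :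
    C⁻¹ * ‖(WithLp.toLp 2 v : EuclideanSpace ℝ ι)‖ ^ 2 ≤ v ⬝ᵥ P⁻¹ *ᵥ v ∧
      v ⬝ᵥ P⁻¹ *ᵥ v ≤ c⁻¹ * ‖(WithLp.toLp 2 v : EuclideanSpace ℝ ι)‖ ^ 2 := by
  have hu := (Matrix.isUnit_iff_isUnit_det _).1 hP.isUnit
  have hPt : Pᵀ = P := by
    have h := hP.isHermitian; rwa [Matrix.IsHermitian, Matrix.conjTranspose_eq_transpose_of_trivial] at h
  have hnn : ∀ u : ι → ℝ, 0 ≤ u ⬝ᵥ P *ᵥ u := fun u => le_trans (by positivity) (hlow u)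
  set w := P⁻¹ *ᵥ v with hw
  have hv : P *ᵥ w = v := by rw [hw, Matrix.mulVec_mulVec, Matrix.mul_nonsing_inv _ hu, Matrix.one_mulVec]
  -- `vᵀ P⁻¹ v = wᵀ P w`
  have hform : v ⬝ᵥ P⁻¹ *ᵥ v = w ⬝ᵥ P *ᵥ w := by
    rw [← hw]
    conv_lhs => rw [← hv, ← Matrix.vecMul_transpose, hPt, ← Matrix.dotProduct_mulVec]
  have hC : 0 < C ∨ ‖(WithLp.toLp 2 v : EuclideanSpace ℝ ι)‖ = 0 := by
    by_cases h0 : ‖(WithLp.toLp 2 v : EuclideanSpace ℝ ι)‖ = 0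
    · exact Or.inr h0
    · left
      have hpos : 0 < ‖(WithLp.toLp 2 v : EuclideanSpace ℝ ι)‖ ^ 2 := by positivity
      have := (hlow v).trans (hup v)
      nlinarith
  constructor
  · -- lower bound via Cauchy–Schwarz: `‖v‖² = wᵀ P v`, `(wᵀ P v)² ≤ (wᵀPw)(vᵀPv) ≤ (wᵀPw) C ‖v‖²`
    have hcs := dotProduct_mulVec_sq_le hPt hnn w v
    have hkey : w ⬝ᵥ P *ᵥ v = ‖(WithLp.toLp 2 v : EuclideanSpace ℝ ι)‖ ^ 2 := by
      rw [Matrix.dotProduct_mulVec, ← Matrix.mulVec_transpose, hPt, hv, ← real_inner_self_eq_norm_sq,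
        EuclideanSpace.inner_toLp_toLp, star_trivial]
    rw [hkey] at hcs
    rw [hform]
    rcases hC with hCpos | h0
    · have hvv := hup v
      have h3 : (‖(WithLp.toLp 2 v : EuclideanSpace ℝ ι)‖ ^ 2) ^ 2 ≤
          (w ⬝ᵥ P *ᵥ w) * (C * ‖(WithLp.toLp 2 v : EuclideanSpace ℝ ι)‖ ^ 2) :=
        hcs.trans (mul_le_mul_of_nonneg_left hvv (hnn w))
      rw [inv_mul_le_iff₀ hCpos]
      by_cases hv0 : ‖(WithLp.toLp 2 v : EuclideanSpace ℝ ι)‖ ^ 2 = 0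
      · rw [hv0]; exact mul_nonneg hCpos.le (hnn w)
      · have hpos : 0 < ‖(WithLp.toLp 2 v : EuclideanSpace ℝ ι)‖ ^ 2 := lt_of_le_of_ne (sq_nonneg _) (Ne.symm hv0)
        refine le_of_mul_le_mul_right ?_ hpos
        nlinarith [h3]
    · rw [h0]; simpa using hnn w
  · -- upper bound via `‖w‖ ≤ ‖v‖/c`
    rw [hform]
    have h1 := norm_inv_mulVec_le hP hc hlow v
    rw [← hw] at h1
    have h2 : w ⬝ᵥ P *ᵥ w ≤ ‖(WithLp.toLp 2 w : EuclideanSpace ℝ ι)‖ * ‖(WithLp.toLp 2 v : EuclideanSpace ℝ ι)‖ := by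
      rw [hv]
      have := real_inner_le_norm (WithLp.toLp 2 v : EuclideanSpace ℝ ι) (WithLp.toLp 2 w)
      rwa [EuclideanSpace.inner_toLp_toLp, star_trivial, mul_comm] at this
    have hvn := norm_nonneg (WithLp.toLp 2 v : EuclideanSpace ℝ ι)
    calc w ⬝ᵥ P *ᵥ w ≤ ‖(WithLp.toLp 2 w : EuclideanSpace ℝ ι)‖ * ‖(WithLp.toLp 2 v : EuclideanSpace ℝ ι)‖ := h2
      _ ≤ ‖(WithLp.toLp 2 v : EuclideanSpace ℝ ι)‖ / c * ‖(WithLp.toLp 2 v : EuclideanSpace ℝ ι)‖ := by gcongr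
      _ = c⁻¹ * ‖(WithLp.toLp 2 v : EuclideanSpace ℝ ι)‖ ^ 2 := by ring

end Forms

/-! ### Scaling of Lebesgue integrals and the Gaussian integral -/

section Scaling

variable {E : Type*} [NormedAddCommGroup E] [NormedSpace ℝ E] [MeasurableSpace E] [BorelSpace E]
  [FiniteDimensional ℝ E] (μ : Measure E) [μ.IsAddHaarMeasure]

/-- `∫ f(r x) dx = |r|^{-dim} ∫ f`. [folklore] -/
theorem lintegral_comp_smul (f : E → ℝ≥0∞) {r : ℝ} (hr : r ≠ 0) :
    ∫⁻ x, f (r • x) ∂μ = ENNReal.ofReal |(r ^ Module.finrank ℝ E)⁻¹| * ∫⁻ x, f x ∂μ := by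
  have h := lintegral_map_equiv f (Homeomorph.smulOfNeZero r hr).toMeasurableEquiv (μ := μ)
  calc ∫⁻ x, f (r • x) ∂μ = ∫⁻ a, f ((Homeomorph.smulOfNeZero r hr).toMeasurableEquiv a) ∂μ := rfl
    _ = ∫⁻ a, f a ∂(Measure.map (fun x : E => r • x) μ) := h.symm
    _ = ENNReal.ofReal |(r ^ Module.finrank ℝ E)⁻¹| * ∫⁻ x, f x ∂μ := by
        rw [Measure.map_addHaar_smul μ hr, lintegral_smul_measure, smul_eq_mul]

end Scaling

section GaussIntegral

open Matrix WithLp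

variable {ι : Type*} [Fintype ι]

/-- **The Gaussian integral on Euclidean `ℝ^ι`**: `∫ e^{-‖y‖²/2} dy = (2π)^{|ι|/2}` (from the total
mass of the standard Gaussian). [folklore] -/
theorem lintegral_exp_neg_norm_sq_div_two :
    ∫⁻ y : EuclideanSpace ℝ ι, ENNReal.ofReal (Real.exp (-‖y‖ ^ 2 / 2)) =
      ENNReal.ofReal (Real.sqrt (2 * Real.pi) ^ Fintype.card ι) := by
  have h1 : (stdGaussian (EuclideanSpace ℝ ι)) Set.univ = 1 := measure_univ
  rw [stdGaussian_eq_withDensity, withDensity_apply _ MeasurableSet.univ, Measure.restrict_univ] at h1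
  simp only [stdGaussianDensity] at h1
  have hA : 0 < (Real.sqrt (2 * Real.pi))⁻¹ ^ Fintype.card ι := by positivity
  simp_rw [ENNReal.ofReal_mul hA.le] at h1
  rw [lintegral_const_mul _ (by fun_prop)] at h1
  have hAinv : ENNReal.ofReal (Real.sqrt (2 * Real.pi) ^ Fintype.card ι) =
      (ENNReal.ofReal ((Real.sqrt (2 * Real.pi))⁻¹ ^ Fintype.card ι))⁻¹ := by
    rw [← ENNReal.ofReal_inv_of_pos hA, inv_pow, inv_inv]
  rw [hAinv]
  exact ENNReal.eq_inv_of_mul_eq_one_left (by rwa [mul_comm] at h1)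

/-- **Upper bound for the Gaussian integral from a lower form bound**: if `c‖y‖² ≤ yᵀPy` (`c > 0`)
then `Z_P ≤ (2π/c)^{|ι|/2}`. [folklore] -/
theorem gaussZ_le [DecidableEq ι] {P : Matrix ι ι ℝ} {c : ℝ} (hc : 0 < c)
    (hlow : ∀ v : ι → ℝ, c * ‖(WithLp.toLp 2 v : EuclideanSpace ℝ ι)‖ ^ 2 ≤ v ⬝ᵥ P *ᵥ v) :
    gaussZ P ≤ ENNReal.ofReal ((Real.sqrt (2 * Real.pi) / Real.sqrt c) ^ Fintype.card ι) := by
  have hsc : 0 < Real.sqrt c := Real.sqrt_pos.2 hc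
  -- pointwise bound
  have h1 : ∀ y : EuclideanSpace ℝ ι, gaussWeight P y ≤ ENNReal.ofReal (Real.exp (-‖Real.sqrt c • y‖ ^ 2 / 2)) := by
    intro y
    apply ENNReal.ofReal_le_ofReal
    apply Real.exp_le_exp.2
    rw [norm_smul, mul_pow, Real.norm_eq_abs, abs_of_pos hsc, Real.sq_sqrt hc.le]
    have := hlow (ofLp y)
    simp only [toLp_ofLp] at this
    linarith
  calc gaussZ P ≤ ∫⁻ y : EuclideanSpace ℝ ι, ENNReal.ofReal (Real.exp (-‖Real.sqrt c • y‖ ^ 2 / 2)) := lintegral_mono h1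
    _ = ENNReal.ofReal |(Real.sqrt c ^ Module.finrank ℝ (EuclideanSpace ℝ ι))⁻¹| *
          ∫⁻ y : EuclideanSpace ℝ ι, ENNReal.ofReal (Real.exp (-‖y‖ ^ 2 / 2)) :=
        lintegral_comp_smul volume (fun y : EuclideanSpace ℝ ι => ENNReal.ofReal (Real.exp (-‖y‖ ^ 2 / 2))) hsc.ne'
    _ = ENNReal.ofReal ((Real.sqrt (2 * Real.pi) / Real.sqrt c) ^ Fintype.card ι) := by
        rw [lintegral_exp_neg_norm_sq_div_two, finrank_euclideanSpace, ← ENNReal.ofReal_mul (abs_nonneg _),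
          abs_of_pos (by positivity), div_pow, inv_mul_eq_div]

/-! ### Marginals on a subset of coordinates -/

variable (J : Finset ι)

/-- Restriction of coordinates to `J`, as a continuous linear map of Euclidean spaces. [folklore] -/
def restrictJ : EuclideanSpace ℝ ι →L[ℝ] EuclideanSpace ℝ J where
  toFun x := toLp 2 fun j : J => x j
  map_add' x y := by ext; simp
  map_smul' m x := by ext; simp
  cont := by
    refine (PiLp.continuous_toLp 2 _).comp ?_
    exact continuous_pi fun j => (PiLp.continuous_apply 2 _ (j : ι))

omit [Fintype ι] in
/-- `restrictJ J x j = x j`. [folklore] -/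
@[simp] theorem restrictJ_apply (x : EuclideanSpace ℝ ι) (j : J) : restrictJ J x j = x (j : ι) := rfl

variable {J}

/-- **Marginals of multivariate Gaussians**: restricting `multivariateGaussian 0 S` to the
coordinates in `J` gives the multivariate Gaussian of the principal submatrix `S_J` (a copy of
Mathlib's `measurePreserving_restrict₂_multivariateGaussian` for an arbitrary finite index type). [folklore] -/
theorem measurePreserving_restrictJ [DecidableEq ι] {S : Matrix ι ι ℝ} (hS : S.PosSemidef) (J : Finset ι) :
    MeasurePreserving (restrictJ J) (multivariateGaussian 0 S)
      (multivariateGaussian 0 (S.submatrix (fun j : J => (j : ι)) (fun j : J => (j : ι)))) where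
  measurable := by fun_prop
  map_eq := by
    apply IsGaussian.ext
    · simp only [id_eq, integral_id_multivariateGaussian]
      rw [ContinuousLinearMap.integral_id_map, integral_id_multivariateGaussian, map_zero]
      exact IsGaussian.integrable_id
    rw [← ContinuousLinearMap.toBilinForm_inj]
    refine LinearMap.BilinForm.ext_basis (EuclideanSpace.basisFun J ℝ).toBasis fun i j ↦ ?_
    rw [ContinuousLinearMap.toBilinForm_apply, ContinuousLinearMap.toBilinForm_apply,
      covarianceBilin_apply_eq_cov, covariance_map]
    · have (i : J) : (fun u ↦ inner ℝ ((EuclideanSpace.basisFun J ℝ).toBasis i) u) ∘ restrictJ J =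
          fun u ↦ u (i : ι) := by ext; simp [PiLp.inner_apply]
      simp_rw [this, covariance_eval_multivariateGaussian hS,
        covarianceBilin_multivariateGaussian (hS.submatrix _)]
      simp
    any_goals exact Measurable.aestronglyMeasurable (by fun_prop)
    · fun_prop
    · exact IsGaussian.memLp_two_id

variable [DecidableEq ι]

variable (J) in
/-- Extension of a vector on `J` by `0`. [folklore] -/
def extendJ (z : J → ℝ) : ι → ℝ := fun i => if h : i ∈ J then z ⟨i, h⟩ else 0

omit [Fintype ι] in
/-- `extendJ` on `J`. [folklore] -/
theorem extendJ_apply_coe (z : J → ℝ) (j : J) : extendJ J z j = z j := by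
  simp [extendJ]

omit [Fintype ι] in
/-- `extendJ` off `J`. [folklore] -/
theorem extendJ_apply_of_not_mem (z : J → ℝ) {i : ι} (hi : i ∉ J) : extendJ J z i = 0 := by
  simp only [extendJ, dif_neg hi]

/-- Sums against the zero extension are sums over `J`. [folklore] -/
theorem sum_mul_extendJ (z : J → ℝ) (f : ι → ℝ) : ∑ i, f i * extendJ J z i = ∑ j : J, f j * z j := by
  rw [← Finset.sum_subset (Finset.subset_univ J) (fun i _ hi => by rw [extendJ_apply_of_not_mem z hi, mul_zero]),
    ← Finset.sum_coe_sort]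
  exact Finset.sum_congr rfl fun j _ => by rw [extendJ_apply_coe]

/-- Sums against the zero extension are sums over `J` (extension on the left). [folklore] -/
theorem sum_extendJ_mul (z : J → ℝ) (f : ι → ℝ) : ∑ i, extendJ J z i * f i = ∑ j : J, z j * f j :=
  calc ∑ i, extendJ J z i * f i = ∑ i, f i * extendJ J z i := Finset.sum_congr rfl fun _ _ => mul_comm _ _
    _ = ∑ j : J, f j * z j := sum_mul_extendJ z f
    _ = ∑ j : J, z j * f j := Finset.sum_congr rfl fun _ _ => mul_comm _ _

/-- The quadratic form of a principal submatrix is the quadratic form of the zero-extended vector. [folklore] -/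
theorem dotProduct_submatrix_mulVec (S : Matrix ι ι ℝ) (z : J → ℝ) :
    z ⬝ᵥ (S.submatrix (fun j : J => (j : ι)) (fun j : J => (j : ι))) *ᵥ z = extendJ J z ⬝ᵥ S *ᵥ extendJ J z := by
  have hmul : ∀ i, (S *ᵥ extendJ J z) i = ∑ k : J, S i k * z k := fun i => sum_mul_extendJ z (fun k => S i k)
  calc z ⬝ᵥ (S.submatrix (fun j : J => (j : ι)) (fun j : J => (j : ι))) *ᵥ z = ∑ j : J, z j * ∑ k : J, S j k * z k := rfl
    _ = ∑ j : J, z j * (S *ᵥ extendJ J z) j := by simp_rw [hmul]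
    _ = ∑ i, extendJ J z i * (S *ᵥ extendJ J z) i := (sum_extendJ_mul z _).symm
    _ = extendJ J z ⬝ᵥ S *ᵥ extendJ J z := rfl

/-- Norm of the zero extension. [folklore] -/
theorem norm_toLp_extendJ (z : J → ℝ) :
    ‖(WithLp.toLp 2 (extendJ J z) : EuclideanSpace ℝ ι)‖ = ‖(WithLp.toLp 2 z : EuclideanSpace ℝ J)‖ := by
  have h : ‖(WithLp.toLp 2 (extendJ J z) : EuclideanSpace ℝ ι)‖ ^ 2 = ‖(WithLp.toLp 2 z : EuclideanSpace ℝ J)‖ ^ 2 := by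
    rw [EuclideanSpace.real_norm_sq_eq, EuclideanSpace.real_norm_sq_eq]
    have := sum_mul_extendJ z (extendJ J z)
    simp_rw [← sq] at this
    rw [this]
    exact Finset.sum_congr rfl fun j _ => by rw [extendJ_apply_coe, sq]
  exact (sq_eq_sq₀ (norm_nonneg _) (norm_nonneg _)).1 h

/-- A principal submatrix of a positive definite real matrix is positive definite. [folklore] -/
theorem posDef_submatrix {S : Matrix ι ι ℝ} (hS : S.PosDef) (J : Finset ι) :
    (S.submatrix (fun j : J => (j : ι)) (fun j : J => (j : ι))).PosDef := by
  refine Matrix.PosDef.of_dotProduct_mulVec_pos (hS.isHermitian.submatrix _) fun z hz => ?_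
  simp only [star_trivial]
  rw [dotProduct_submatrix_mulVec]
  have hne : extendJ J z ≠ 0 := by
    intro h
    apply hz
    funext j
    have := congr_fun h (j : ι)
    rwa [extendJ_apply_coe] at this
  simpa using hS.dotProduct_mulVec_pos hne

/-- The cube `{|z_j| ≤ η ∀ j}` in Euclidean `ℝ^J` has volume `(2η)^{|J|}`. [folklore] -/
theorem volume_cube (κ : Type*) [Fintype κ] {η : ℝ} (hη : 0 ≤ η) :
    volume {z : EuclideanSpace ℝ κ | ∀ j, |z j| ≤ η} = ENNReal.ofReal ((2 * η) ^ Fintype.card κ) := by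
  have h := (PiLp.volume_preserving_toLp κ).measure_preimage
    (s := {z : EuclideanSpace ℝ κ | ∀ j, |z j| ≤ η}) ?_
  · rw [← h]
    have hset : (toLp 2) ⁻¹' {z : EuclideanSpace ℝ κ | ∀ j, |z j| ≤ η} = Set.pi Set.univ fun _ : κ => Set.Icc (-η) η := by
      ext z; simp [abs_le, Pi.le_def, forall_and]
    rw [hset, volume_pi_pi]
    simp only [Real.volume_Icc, Finset.prod_const, Finset.card_univ]
    rw [← ENNReal.ofReal_pow (by linarith)]
    congr 2; ring
  · refine (MeasurableSet.nullMeasurableSet ?_)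
    have : {z : EuclideanSpace ℝ κ | ∀ j, |z j| ≤ η} = ⋂ j, {z | |z j| ≤ η} := by ext; simp
    rw [this]
    exact MeasurableSet.iInter fun j => measurableSet_le (by fun_prop) measurable_const

/-- **Small cubes under a multivariate Gaussian (Chatterjee's `cruciallower`, §12)**: if the
precision matrix `P` satisfies `c‖v‖² ≤ vᵀPv ≤ C‖v‖²` (`c, C > 0`), then for every set `J` of
coordinates and `η > 0`, the Gaussian `N(0, P⁻¹)` gives the cube `{|x_j| ≤ η, j ∈ J}` probability
at least `(2η (c/2π)^{1/2} e^{-Cη²/2})^{|J|}` (marginal density bounded below by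
`(c/2π)^{|J|/2} e^{-C‖x‖²/2}`). [cite: arXiv160201222, §12 and Thm. 14.1 (proof)] -/
theorem le_multivariateGaussian_cube {P : Matrix ι ι ℝ} (hP : P.PosDef) {c C : ℝ} (hc : 0 < c) (hC : 0 < C)
    (hlow : ∀ v : ι → ℝ, c * ‖(WithLp.toLp 2 v : EuclideanSpace ℝ ι)‖ ^ 2 ≤ v ⬝ᵥ P *ᵥ v)
    (hup : ∀ v : ι → ℝ, v ⬝ᵥ P *ᵥ v ≤ C * ‖(WithLp.toLp 2 v : EuclideanSpace ℝ ι)‖ ^ 2)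
    (J : Finset ι) {η : ℝ} (hη : 0 < η) :
    ENNReal.ofReal ((2 * η * (Real.sqrt c / Real.sqrt (2 * Real.pi)) * Real.exp (-(C * η ^ 2 / 2))) ^ J.card) ≤
      multivariateGaussian 0 P⁻¹ {x : EuclideanSpace ℝ ι | ∀ j ∈ J, |x j| ≤ η} := by
  -- the covariance and its principal submatrix
  set Sg := P⁻¹ with hSg
  set SgJ := Sg.submatrix (fun j : J => (j : ι)) (fun j : J => (j : ι)) with hSgJ
  have hSgpd : Sg.PosDef := hP.inv
  have hSgJpd : SgJ.PosDef := posDef_submatrix hSgpd J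
  -- form bounds for `Sg`, `Sg_J`, `P' = Sg_J⁻¹`
  have hSgb := inv_form_bounds hP hc hlow hup
  have hSgJlow : ∀ z : J → ℝ, C⁻¹ * ‖(WithLp.toLp 2 z : EuclideanSpace ℝ J)‖ ^ 2 ≤ z ⬝ᵥ SgJ *ᵥ z := fun z => by
    rw [hSgJ, dotProduct_submatrix_mulVec, ← norm_toLp_extendJ]; exact (hSgb _).1
  have hSgJup : ∀ z : J → ℝ, z ⬝ᵥ SgJ *ᵥ z ≤ c⁻¹ * ‖(WithLp.toLp 2 z : EuclideanSpace ℝ J)‖ ^ 2 := fun z => by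
    rw [hSgJ, dotProduct_submatrix_mulVec, ← norm_toLp_extendJ]; exact (hSgb _).2
  set P' := SgJ⁻¹ with hP'
  have hP'b := inv_form_bounds hSgJpd (inv_pos.2 hC) hSgJlow hSgJup
  simp only [inv_inv] at hP'b
  -- the marginal and its density
  obtain ⟨hdens, hZ0, hZtop⟩ := multivariateGaussian_eq_withDensity hSgJpd
  have hmarg := (measurePreserving_restrictJ hSgpd.posSemidef J).map_eq
  set cube := {z : EuclideanSpace ℝ J | ∀ j, |z j| ≤ η} with hcube
  have hcubem : MeasurableSet cube := by
    have : cube = ⋂ j, {z : EuclideanSpace ℝ J | |z j| ≤ η} := by ext; simp [hcube]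
    rw [this]
    exact MeasurableSet.iInter fun j => measurableSet_le (by fun_prop) measurable_const
  have hpre : {x : EuclideanSpace ℝ ι | ∀ j ∈ J, |x j| ≤ η} = restrictJ J ⁻¹' cube := by
    ext x
    simp only [Set.mem_setOf_eq, Set.mem_preimage, hcube, restrictJ_apply, Subtype.forall]
  rw [hpre, ← Measure.map_apply (by fun_prop) hcubem, hmarg, ← hSgJ, hdens, Measure.smul_apply,
    withDensity_apply _ hcubem, smul_eq_mul]
  -- lower bound for the integral over the cube
  set k := Fintype.card J with hk
  have hkJ : J.card = k := by rw [hk, Fintype.card_coe]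
  have hwlow : ∀ z ∈ cube, ENNReal.ofReal (Real.exp (-(C * k * η ^ 2 / 2))) ≤ gaussWeight P' z := by
    intro z hz
    apply ENNReal.ofReal_le_ofReal
    apply Real.exp_le_exp.2
    have h1 := (hP'b (ofLp z)).2
    simp only [toLp_ofLp] at h1
    have h2 : ‖z‖ ^ 2 ≤ k * η ^ 2 := by
      rw [EuclideanSpace.real_norm_sq_eq]
      calc ∑ j, (z j) ^ 2 ≤ ∑ _j : J, η ^ 2 := Finset.sum_le_sum fun j _ => by
            have := hz j; rw [abs_le] at this; nlinarith
        _ = k * η ^ 2 := by rw [Finset.sum_const, Finset.card_univ, nsmul_eq_mul]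
    have h3 : 0 ≤ C * ‖z‖ ^ 2 := by positivity
    nlinarith
  have hI : ENNReal.ofReal (Real.exp (-(C * k * η ^ 2 / 2))) * ENNReal.ofReal ((2 * η) ^ k) ≤
      ∫⁻ z in cube, gaussWeight P' z := by
    calc ENNReal.ofReal (Real.exp (-(C * k * η ^ 2 / 2))) * ENNReal.ofReal ((2 * η) ^ k)
        = ENNReal.ofReal (Real.exp (-(C * k * η ^ 2 / 2))) * volume cube := by rw [volume_cube J hη.le]
      _ = ∫⁻ _z in cube, ENNReal.ofReal (Real.exp (-(C * k * η ^ 2 / 2))) := (setLIntegral_const _ _).symm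
      _ ≤ ∫⁻ z in cube, gaussWeight P' z := setLIntegral_mono (measurable_gaussWeight _) hwlow
  -- upper bound for the normalising constant
  have hZle : gaussZ P' ≤ ENNReal.ofReal ((Real.sqrt (2 * Real.pi) / Real.sqrt c) ^ k) := gaussZ_le hc (fun z => (hP'b z).1)
  have hA : 0 < (Real.sqrt (2 * Real.pi) / Real.sqrt c) ^ k := by positivity
  have hZinv : ENNReal.ofReal ((Real.sqrt c / Real.sqrt (2 * Real.pi)) ^ k) ≤ (gaussZ P')⁻¹ := by
    have h1 : (ENNReal.ofReal ((Real.sqrt (2 * Real.pi) / Real.sqrt c) ^ k))⁻¹ ≤ (gaussZ P')⁻¹ :=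
      ENNReal.inv_le_inv.2 hZle
    refine le_trans (le_of_eq ?_) h1
    rw [← ENNReal.ofReal_inv_of_pos hA, ← inv_pow, inv_div]
  -- assemble
  calc ENNReal.ofReal ((2 * η * (Real.sqrt c / Real.sqrt (2 * Real.pi)) * Real.exp (-(C * η ^ 2 / 2))) ^ J.card)
      = ENNReal.ofReal ((Real.sqrt c / Real.sqrt (2 * Real.pi)) ^ k) *
          (ENNReal.ofReal (Real.exp (-(C * k * η ^ 2 / 2))) * ENNReal.ofReal ((2 * η) ^ k)) := by
        rw [hkJ, ← ENNReal.ofReal_mul (Real.exp_pos _).le, ← ENNReal.ofReal_mul (by positivity)]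
        congr 1
        rw [mul_pow, mul_pow, ← Real.exp_nat_mul]
        have e : (k : ℝ) * (-(C * η ^ 2 / 2)) = -(C * k * η ^ 2 / 2) := by ring
        rw [e]; ring
    _ ≤ (gaussZ P')⁻¹ * ∫⁻ z in cube, gaussWeight P' z := mul_le_mul' hZinv hI

/-! ### Coordinate tails and the union bound (Chatterjee's `gaussmax`, §12) -/

/-- **Two-sided tail of the centred real Gaussian**: `P(|Y| ≥ x) ≤ 2 e^{-x²/(2v)}`. [folklore] -/
theorem gaussianReal_real_abs_ge_le (v : ℝ≥0) {x : ℝ} (hx : 0 ≤ x) :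
    (gaussianReal 0 v).real {y | x ≤ |y|} ≤ 2 * Real.exp (-x ^ 2 / (2 * v)) := by
  have h := Literature.Probability.Process.BrownianModulus.hasSubgaussianMGF_id_gaussianReal v
  have h1 := h.measure_ge_le hx
  have h2 := h.neg.measure_ge_le hx
  have hsub : {y : ℝ | x ≤ |y|} ⊆ {y | x ≤ id y} ∪ {y | x ≤ (-id) y} := by
    intro y hy
    simp only [Set.mem_setOf_eq, id, Pi.neg_apply, Set.mem_union] at hy ⊢
    rcases le_or_gt 0 y with h0 | h0
    · left; rwa [abs_of_nonneg h0] at hy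
    · right; rwa [abs_of_neg h0] at hy
  calc (gaussianReal 0 v).real {y | x ≤ |y|} ≤ (gaussianReal 0 v).real ({y | x ≤ id y} ∪ {y | x ≤ (-id) y}) :=
        measureReal_mono hsub
    _ ≤ (gaussianReal 0 v).real {y | x ≤ id y} + (gaussianReal 0 v).real {y | x ≤ (-id) y} := measureReal_union_le _ _
    _ ≤ Real.exp (-x ^ 2 / (2 * v)) + Real.exp (-x ^ 2 / (2 * v)) := add_le_add h1 h2
    _ = 2 * Real.exp (-x ^ 2 / (2 * v)) := by ring

/-- The norm of a basis vector of Euclidean space (as `toLp` of `Pi.single`). [folklore] -/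
theorem norm_toLp_single (i : ι) : ‖(WithLp.toLp 2 (Pi.single i (1 : ℝ)) : EuclideanSpace ℝ ι)‖ = 1 := by
  rw [EuclideanSpace.norm_eq]
  simp [Pi.single_apply, Finset.sum_ite_eq']


/-- Diagonal entries of the inverse of a positive definite matrix with lower form bound `c` are
in `(0, c⁻¹]`. [folklore] -/
theorem inv_diag_bounds {Q : Matrix ι ι ℝ} (hQ : Q.PosDef) {c C : ℝ} (hc : 0 < c)
    (hlow : ∀ v : ι → ℝ, c * ‖(WithLp.toLp 2 v : EuclideanSpace ℝ ι)‖ ^ 2 ≤ v ⬝ᵥ Q *ᵥ v)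
    (hup : ∀ v : ι → ℝ, v ⬝ᵥ Q *ᵥ v ≤ C * ‖(WithLp.toLp 2 v : EuclideanSpace ℝ ι)‖ ^ 2) (i : ι) :
    0 < Q⁻¹ i i ∧ Q⁻¹ i i ≤ c⁻¹ := by
  have hdiag : Q⁻¹ i i = Pi.single i (1 : ℝ) ⬝ᵥ Q⁻¹ *ᵥ Pi.single i 1 := by
    simp [Matrix.mulVec, dotProduct, Pi.single_apply, Finset.sum_ite_eq']
  constructor
  · rw [hdiag]
    have hne : (Pi.single i (1 : ℝ) : ι → ℝ) ≠ 0 := fun h => by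
      have := congr_fun h i; simp at this
    simpa using hQ.inv.dotProduct_mulVec_pos hne
  · rw [hdiag]
    have h := (inv_form_bounds hQ hc hlow hup (Pi.single i 1)).2
    rwa [norm_toLp_single, one_pow, mul_one] at h

/-- **Coordinate tails of a multivariate Gaussian**: if the precision matrix `Q` satisfies
`c‖v‖² ≤ vᵀQv ≤ C‖v‖²` then `P(|s_i| ≥ x) ≤ 2 e^{-c x²/2}` under `N(0, Q⁻¹)`. [cite: arXiv160201222, §12 (`gaussmax`)] -/
theorem multivariateGaussian_real_coord_abs_ge_le {Q : Matrix ι ι ℝ} (hQ : Q.PosDef) {c C : ℝ} (hc : 0 < c)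
    (hlow : ∀ v : ι → ℝ, c * ‖(WithLp.toLp 2 v : EuclideanSpace ℝ ι)‖ ^ 2 ≤ v ⬝ᵥ Q *ᵥ v)
    (hup : ∀ v : ι → ℝ, v ⬝ᵥ Q *ᵥ v ≤ C * ‖(WithLp.toLp 2 v : EuclideanSpace ℝ ι)‖ ^ 2) (i : ι)
    {x : ℝ} (hx : 0 ≤ x) :
    (multivariateGaussian 0 Q⁻¹).real {s : EuclideanSpace ℝ ι | x ≤ |s i|} ≤ 2 * Real.exp (-(c * x ^ 2 / 2)) := by
  obtain ⟨hpos, hle⟩ := inv_diag_bounds hQ hc hlow hup i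
  have hmp := measurePreserving_eval_multivariateGaussian (μ := (0 : EuclideanSpace ℝ ι)) hQ.inv.posSemidef (i := i)
  have hset : {s : EuclideanSpace ℝ ι | x ≤ |s i|} = (fun s : EuclideanSpace ℝ ι => s i) ⁻¹' {y | x ≤ |y|} := rfl
  have hmeas : MeasurableSet {y : ℝ | x ≤ |y|} := measurableSet_le measurable_const (by fun_prop)
  rw [hset, measureReal_def, ← Measure.map_apply (by fun_prop) hmeas, hmp.map_eq, ← measureReal_def]
  simp only [PiLp.zero_apply]
  refine (gaussianReal_real_abs_ge_le _ hx).trans ?_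
  have hv : ((Q⁻¹ i i).toNNReal : ℝ) = Q⁻¹ i i := Real.coe_toNNReal _ hpos.le
  rw [hv]
  gcongr
  rw [neg_div, neg_le_neg_iff, div_le_div_iff₀ (by positivity) (by positivity)]
  have hcv : c * Q⁻¹ i i ≤ 1 := by
    have := mul_le_mul_of_nonneg_left hle hc.le; rwa [mul_inv_cancel₀ hc.ne'] at this
  nlinarith [mul_le_mul_of_nonneg_left hcv (by positivity : 0 ≤ 2 * x ^ 2)]

/-- **Union bound for the sup-norm of a multivariate Gaussian (Chatterjee's `gaussmax`)**:
`P(max_i |s_i| ≤ x) ≥ 1 - 2|ι| e^{-c x²/2}` under `N(0, Q⁻¹)` when `c‖v‖² ≤ vᵀQv`. [cite: arXiv160201222, §12 (`gaussmax`)] -/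
theorem multivariateGaussian_real_forall_abs_le_ge {Q : Matrix ι ι ℝ} (hQ : Q.PosDef) {c C : ℝ} (hc : 0 < c)
    (hlow : ∀ v : ι → ℝ, c * ‖(WithLp.toLp 2 v : EuclideanSpace ℝ ι)‖ ^ 2 ≤ v ⬝ᵥ Q *ᵥ v)
    (hup : ∀ v : ι → ℝ, v ⬝ᵥ Q *ᵥ v ≤ C * ‖(WithLp.toLp 2 v : EuclideanSpace ℝ ι)‖ ^ 2)
    {x : ℝ} (hx : 0 ≤ x) :
    1 - 2 * Fintype.card ι * Real.exp (-(c * x ^ 2 / 2)) ≤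
      (multivariateGaussian 0 Q⁻¹).real {s : EuclideanSpace ℝ ι | ∀ i, |s i| ≤ x} := by
  set μ := multivariateGaussian 0 Q⁻¹ with hμ
  set E := {s : EuclideanSpace ℝ ι | ∀ i, |s i| ≤ x} with hE
  have hEm : MeasurableSet E := by
    have : E = ⋂ i, {s : EuclideanSpace ℝ ι | |s i| ≤ x} := by ext; simp [hE]
    rw [this]; exact MeasurableSet.iInter fun i => measurableSet_le (by fun_prop) measurable_const
  have hcompl : Eᶜ ⊆ ⋃ i, {s : EuclideanSpace ℝ ι | x ≤ |s i|} := by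
    intro s hs
    simp only [hE, Set.mem_compl_iff, Set.mem_setOf_eq, not_forall, not_le] at hs
    obtain ⟨i, hi⟩ := hs
    exact Set.mem_iUnion.2 ⟨i, hi.le⟩
  have h1 : μ.real Eᶜ ≤ 2 * Fintype.card ι * Real.exp (-(c * x ^ 2 / 2)) := by
    calc μ.real Eᶜ ≤ μ.real (⋃ i, {s : EuclideanSpace ℝ ι | x ≤ |s i|}) := measureReal_mono hcompl
      _ ≤ ∑ i, μ.real {s : EuclideanSpace ℝ ι | x ≤ |s i|} := measureReal_iUnion_fintype_le _
      _ ≤ ∑ _i : ι, 2 * Real.exp (-(c * x ^ 2 / 2)) :=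
          Finset.sum_le_sum fun i _ => multivariateGaussian_real_coord_abs_ge_le hQ hc hlow hup i hx
      _ = 2 * Fintype.card ι * Real.exp (-(c * x ^ 2 / 2)) := by
          rw [Finset.sum_const, Finset.card_univ, nsmul_eq_mul]; ring
  have h2 : μ.real E = 1 - μ.real Eᶜ := by
    rw [measureReal_compl hEm, probReal_univ]; ring
  linarith

/-- The shifted form used in Theorem 14.2: for every `m`,
`P(|s_i + m_i| ≤ ‖m‖ + x ∀ i) ≥ 1 - 2|ι| e^{-c x²/2}`. [cite: arXiv160201222, Thm. 14.2 (proof)] -/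
theorem multivariateGaussian_real_forall_abs_add_le_ge {Q : Matrix ι ι ℝ} (hQ : Q.PosDef) {c C : ℝ} (hc : 0 < c)
    (hlow : ∀ v : ι → ℝ, c * ‖(WithLp.toLp 2 v : EuclideanSpace ℝ ι)‖ ^ 2 ≤ v ⬝ᵥ Q *ᵥ v)
    (hup : ∀ v : ι → ℝ, v ⬝ᵥ Q *ᵥ v ≤ C * ‖(WithLp.toLp 2 v : EuclideanSpace ℝ ι)‖ ^ 2)
    (m : EuclideanSpace ℝ ι) {x : ℝ} (hx : 0 ≤ x) :
    1 - 2 * Fintype.card ι * Real.exp (-(c * x ^ 2 / 2)) ≤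
      (multivariateGaussian 0 Q⁻¹).real {s : EuclideanSpace ℝ ι | ∀ i, |s i + m i| ≤ ‖m‖ + x} := by
  refine (multivariateGaussian_real_forall_abs_le_ge hQ hc hlow hup hx).trans (measureReal_mono fun s hs i => ?_)
  have hmi : |m i| ≤ ‖m‖ := by
    refine le_of_sq_le_sq ?_ (norm_nonneg _)
    rw [EuclideanSpace.real_norm_sq_eq, sq_abs]
    exact Finset.single_le_sum (f := fun j => (m j) ^ 2) (fun _ _ => sq_nonneg _) (Finset.mem_univ i)
  calc |s i + m i| ≤ |s i| + |m i| := abs_add_le _ _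
    _ ≤ x + ‖m‖ := add_le_add (hs i) hmi
    _ = ‖m‖ + x := add_comm _ _

end GaussIntegral

end GaussianToolkit

end Literature.MathematicalPhysics.QuantumFieldTheory
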